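import Summits.BirchSwinnertonDyer.BirchSwinnertonDyer.Theorems.KolyvaginDepthDoorDepthTableKuriharaESideFive1
import Summits.BirchSwinnertonDyer.BirchSwinnertonDyer.Theorems.KolyvaginDepthDoorDepthTableRowKitPrint
import Literature.NumberTheory.EllipticCurves.GlobalMinimalModelNumberFieldBaseChangeProofs
import Literature.NumberTheory.EllipticCurves.BSDSelmerPConverseSerreProofs
import HarnessLib

/-!
# Route `KolyvaginDepthDoor`, crux `KolyvaginDepthSupplyKN` (stmt-BirchSwinnertonDyer-22820) —
# DEPTH TABLE v17, ROW `571b1` at `(p, d_K) = (5, −7)` IN THE KURIHARA CURRENCY: a THIRD curve of the table whose Heegner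
# twist has a Kurihara record in the tree — the crux's clause at `571b1` modulo print and two in-tree certificates

Helper file of the lead prover of line `levelone` (kdd-p1 g21; `--supports stmt-BirchSwinnertonDyer-22820
--as helper`); it closes nothing and BSD is NOT proved by it.

The lineage read `571b1 = [0,1,1,−4,2]` (`N = 571` prime, rank `2`) at the Heegner field `ℚ(√−2)` (`d_K = −8`, twist conductor
`36544`, no tree record). But `ℚ(√−7)` is ALSO a Heegner field for `571` (`(−7/571) = +1`) and the twist `571b1^{(−7)}` has conductor
`571·49 = 27979 < 6·10⁴`: its minimal model `T₀ = [0, −1, 1, −212, −1184]` (`Δ = −7⁶·571`; `(1,−2,0,−1/2) • T₀ = E.quadraticTwist (−7)`)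
IS Cremona's `27979d1`, which carries tree records `cert_27979d1` = `(5, 11, ν = 1, δ̃ ≡ 1)`, `(11, 1013, 1, 8)`, `(13, 53, 1, 3)`
(`KuriharaCertificates/RecordsN027979to028076.lean`, job of the kurihara fleet). The curve's own record `cert_571b1` @ `(5, 11·41, 2, 3)`
and its E-side lemmas (`C571b1.card_11`, `card_41`, `isCyclicKolyvaginLevel_5_451`, `nonAnomalous_5`) are in
`KolyvaginDepthDoorDepthTableKuriharaESideFive1`. This file builds the twist model (`minTwist7_*`: elliptic, globally minimal by the
`Δ`-criterion, `intModel`, the isomorphism, Kodaira–Néron at `5`, `a_5(T₀) = 2`, the cyclic level `11`: `#T̃₀(𝔽₁₁) = 15`) and assembles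
the row with the generic `cruxBody_of_kuriharaClaims_spade` (`5` is INERT in `ℚ(√−7)`: W. Zhang's ♠ supply; `571` prime).

RESULT `C571b1.cruxBody_of_kuriharaClaims_5_neg7`: for EVERY imaginary quadratic `K` with `d_K = −7`, the clause of `KolyvaginDepthSupplyKN`
holds at `W = 571b1` VERBATIM, CONDITIONAL on Kim 2026 Thm. 1.11, modularity, Mazur 1978 Cor. 4.1, W. Zhang 2014 L8.4 (1)/9.1 BY NAME and the
CLAIMS of `cert_571b1` @ `(5, 451)` and `cert_27979d1` @ `(5, 11)`. Third row of the table closed with no numerical datum owed. Per curve;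
nothing class-wide (the open stub (S♭) is untouched); BSD is NOT proved by it.

References: [Kim2022StructureSelmer] Thm. 1.11; [WZhang2014] Lemma 8.4 (1), Thm. 9.1; [Mazur1978] Cor. 4.1; [SilvermanAEC2009] VII.1
Rem. 1.1, VIII.8, X.5 Cor. 5.4; [CremonaAlgorithms1997] Table 1 (571b1) and Cremona's database (27979d1).
-/

set_option linter.dupNamespace false

noncomputable section

open scoped Classical NumberField

namespace Summit.BirchSwinnertonDyer.BirchSwinnertonDyer.Theorems.KolyvaginDepthDoor

open Literature.NumberTheory.EllipticCurves Literature.NumberTheory.EllipticCurves.ModularForms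
  WeierstrassCurve NumberField IsDedekindDomain
open Summit.BirchSwinnertonDyer.BirchSwinnertonDyer.Theorems
open Summit.BirchSwinnertonDyer.BirchSwinnertonDyer.Rank2Observatory
open Summit.BirchSwinnertonDyer.BirchSwinnertonDyer.Rank1Residual (IntModel.frobeniusTrace_eq
  IntModel.integralModelInt_eq_of_map_eq)
open Summit.BirchSwinnertonDyer.Rank1Residual.Supersingular (natCard_point_eq_of_countPoints countPoints_eq_of_fast)
open Summit.BirchSwinnertonDyer.Rank1Residual.Additive (card_torsion_le_of_intModel_of_card
  isKolyvaginPrime_of_intModel_of_card isKolyvaginProduct_mul)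

namespace C571b1

/-! ## The minimal model `T₀ = [0, −1, 1, −212, −1184]` of the twist `571b1^{(−7)}` (Cremona `27979d1`) -/

/-- `T₀ = [0, −1, 1, −212, −1184]` is an elliptic curve over `ℚ` (`Δ = −67177579 ≠ 0`, kernel-checked). [folklore] -/
theorem minTwist7_isElliptic : ((⟨0, -1, 1, -212, -1184⟩ : WeierstrassCurve ℤ).map (Int.castRingHom ℚ)).IsElliptic := by
  rw [WeierstrassCurve.isElliptic_iff, WeierstrassCurve.map_Δ, isUnit_iff_ne_zero, eq_intCast, Int.cast_ne_zero]
  decide +kernel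

/-- **`T₀ = [0, −1, 1, −212, −1184]` is a GLOBAL MINIMAL model**: `Δ(T₀) = −7⁶·571` is twelfth-power-free (`q¹² ∣ Δ` forces `q < 5`,
and `2, 3 ∤ Δ`), Silverman's `Δ`-criterion. [cite: SilvermanAEC2009, VII.1 Remark 1.1 and VIII.8] -/
theorem minTwist7_isGloballyMinimal : ((⟨0, -1, 1, -212, -1184⟩ : WeierstrassCurve ℤ).map (Int.castRingHom ℚ)).IsGloballyMinimal := by
  have hbc : (⟨0, -1, 1, -212, -1184⟩ : WeierstrassCurve ℤ).map (Int.castRingHom ℚ) =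
      (⟨0, -1, 1, -212, -1184⟩ : WeierstrassCurve ℤ).baseChange ℚ := by
    ext <;> simp [WeierstrassCurve.baseChange, WeierstrassCurve.map]
  rw [hbc]
  refine isGloballyMinimal_baseChange_int_of_finrank_mul_lt_twelve _ ℚ 11 (fun q hq hdvd ↦ ?_)
    (by rw [Module.finrank_self]; norm_num)
  have hΔ : (⟨0, -1, 1, -212, -1184⟩ : WeierstrassCurve ℤ).Δ = -(67177579 : ℕ) := by decide +kernel
  rw [hΔ, Int.dvd_neg] at hdvd
  have h1 : q ^ 12 ∣ 67177579 := by exact_mod_cast hdvd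
  have hle : q ^ 12 ≤ 67177579 := Nat.le_of_dvd (by norm_num) h1
  have hqM : q < 5 := by
    by_contra h
    have hM : 5 ^ 12 ≤ q ^ 12 := Nat.pow_le_pow_left (by omega) 12
    norm_num at hM
    omega
  interval_cases q <;> first | (norm_num at hq; done) | exact absurd h1 (by decide +kernel)

/-- The integral model `[0, −1, 1, −212, −1184]` is its own `integralModelInt` (globally minimal). [folklore] -/
theorem minTwist7_intModel :
    haveI := minTwist7_isGloballyMinimal;
    integralModelInt ((⟨0, -1, 1, -212, -1184⟩ : WeierstrassCurve ℤ).map (Int.castRingHom ℚ)) = ⟨0, -1, 1, -212, -1184⟩ := by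
  haveI := minTwist7_isGloballyMinimal
  exact IntModel.integralModelInt_eq_of_map_eq _ rfl

/-- **`T₀` is `ℚ`-isomorphic to the tree's twist `E.quadraticTwist (−7)` of `E = 571b1`** by `(u, r, s, t) = (1, −2, 0, −1/2)`:
`(u,r,s,t) • T₀ = ⟨0, d·b₂/4, 0, d²·b₄/2, d³·b₆/4⟩` with `(b₂, b₄, b₆)(E) = (4, −8, 9)`, `d = −7`. [cite: SilvermanAEC2009, X.5 Cor. 5.4] -/
theorem minTwist7_smul_eq :
    (⟨1, (-2 : ℚ), (0 : ℚ), -((1 : ℚ) / 2)⟩ : WeierstrassCurve.VariableChange ℚ) •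
        ((⟨0, -1, 1, -212, -1184⟩ : WeierstrassCurve ℤ).map (Int.castRingHom ℚ)) =
      ((⟨0, 1, 1, -4, 2⟩ : WeierstrassCurve ℤ).map (Int.castRingHom ℚ)).quadraticTwist ((-7) : ℚ) := by
  haveI := isElliptic_c571b1
  haveI := isGloballyMinimal_c571b1
  ext <;> simp only [WeierstrassCurve.map_a₁, WeierstrassCurve.map_a₂, WeierstrassCurve.map_a₃,
      WeierstrassCurve.map_a₄, WeierstrassCurve.map_a₆, WeierstrassCurve.variableChange_a₁,
      WeierstrassCurve.variableChange_a₂, WeierstrassCurve.variableChange_a₃,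
      WeierstrassCurve.variableChange_a₄, WeierstrassCurve.variableChange_a₆, WeierstrassCurve.quadraticTwist,
      WeierstrassCurve.b₂, WeierstrassCurve.b₄, WeierstrassCurve.b₆, Units.val_one, inv_one,
      eq_intCast] <;> norm_num

/-- `#T̃₀(𝔽₅) = 4`, i.e. `a_5(T₀) = 2` (non-anomalous), kernel-decided (`countPointsFast`). [cite: SilvermanAEC2009, V.2] -/
theorem minTwist7_card_5 :
    Nat.card (((⟨0, -1, 1, -212, -1184⟩ : WeierstrassCurve ℤ).map (Int.castRingHom (ZMod 5))).toAffine.Point) = 4 :=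
  haveI : Fact (Nat.Prime 5) := ⟨by norm_num⟩
  natCard_point_eq_of_countPoints 0 (-1) 1 (-212) (-1184) 5 (by norm_num) (by decide +kernel) (n := 4)
    (countPoints_eq_of_fast (by decide +kernel))

/-- `#T̃₀(𝔽₁₁) = 15 = 5·3` (`11 ≡ 1`, `a_11(T₀) = −3 ≡ 2 (mod 5)`, `25 ∤ 15`), kernel-decided (`countPointsFast`). [cite: Kim2022StructureSelmer, §1.2.2 (PDF p. 5)] -/
theorem minTwist7_card_11 :
    Nat.card (((⟨0, -1, 1, -212, -1184⟩ : WeierstrassCurve ℤ).map (Int.castRingHom (ZMod 11))).toAffine.Point) = 15 :=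
  haveI : Fact (Nat.Prime 11) := ⟨by norm_num⟩
  natCard_point_eq_of_countPoints 0 (-1) 1 (-212) (-1184) 11 (by norm_num) (by decide +kernel) (n := 15)
    (countPoints_eq_of_fast (by decide +kernel))

/-- **Kodaira–Néron for `T₀` at `5`**: `|Δ(T₀)| = 7⁶·571 < 37⁵`; the only prime `< 37` dividing it is `7`, with exponent `6`, `5 ∤ 6`;
larger primes have exponent `< 5`. [cite: SilvermanAEC2009, VII.5.1, VIII.8] -/
theorem minTwist7_kodairaNeron_5 :
    haveI := minTwist7_isElliptic; haveI := minTwist7_isGloballyMinimal;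
    ∀ v : HeightOneSpectrum (𝓞 ℚ),
      ((⟨0, -1, 1, -212, -1184⟩ : WeierstrassCurve ℤ).map (Int.castRingHom ℚ)).HasMultiplicativeReductionAt v →
      ¬ 5 ∣ ((⟨0, -1, 1, -212, -1184⟩ : WeierstrassCurve ℤ).map (Int.castRingHom ℚ)).ordMinimalDiscriminant v := by
  haveI := minTwist7_isElliptic
  haveI := minTwist7_isGloballyMinimal
  exact not_dvd_ordMinimalDiscriminant_of_intModel_table minTwist7_intModel (p := 5) (Δ₀ := (-67177579))
    (by decide +kernel) (B := 37) (by decide +kernel)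
    (by
      intro q hq hqP hqd
      have hn : ((-67177579 : ℤ).natAbs) = 7 ^ 6 * (571 ^ 1) := by norm_num
      rw [hn] at hqd ⊢
      rcases (Nat.Prime.dvd_mul hqP).mp hqd with h | h0
      · obtain rfl := (Nat.prime_dvd_prime_iff_eq hqP (by norm_num)).mp (hqP.dvd_of_dvd_pow h)
        exact ⟨6, by simp, by decide +kernel, by decide +kernel, by norm_num⟩
      · obtain rfl := (Nat.prime_dvd_prime_iff_eq hqP (by norm_num)).mp (hqP.dvd_of_dvd_pow h0)
        exact absurd (Finset.mem_range.mp hq) (by norm_num)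
      )

/-- **`11` is a cyclic Kolyvagin level for `(T₀, 5)`** — the level of the tree record `cert_27979d1` at `p = 5`.
[cite: Kim2022StructureSelmer, §1.2.2 (PDF p. 5)] -/
theorem minTwist7_isCyclicKolyvaginLevel_5_11 :
    haveI := minTwist7_isGloballyMinimal; haveI := Fact.mk (by norm_num : Nat.Prime 5);
    IsCyclicKolyvaginLevel ((⟨0, -1, 1, -212, -1184⟩ : WeierstrassCurve ℤ).map (Int.castRingHom ℚ)) 5 11 := by
  haveI := minTwist7_isElliptic
  haveI := minTwist7_isGloballyMinimal
  haveI := Fact.mk (by norm_num : Nat.Prime 5)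
  haveI : Fact (Nat.Prime 11) := ⟨by norm_num⟩
  have h11 : Kato.IsKolyvaginPrime ((⟨0, -1, 1, -212, -1184⟩ : WeierstrassCurve ℤ).map (Int.castRingHom ℚ)) 5 1 11 :=
    isKolyvaginPrime_of_intModel_of_card minTwist7_intModel 5 1 11 (by norm_num) (by decide +kernel) (by decide)
      minTwist7_card_11 (by norm_num)
  refine ⟨⟨Nat.squarefree_iff_nodup_primeFactorsList (by norm_num) |>.mpr (by simp), fun ℓ hℓ ↦ ?_⟩, fun ℓ hℓ hdvd ↦ ?_⟩
  · rw [show (11 : ℕ).primeFactors = {11} from (Nat.Prime.primeFactors (by norm_num)), Finset.mem_singleton] at hℓ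
    exact hℓ ▸ h11
  · obtain rfl := (Nat.prime_dvd_prime_iff_eq hℓ.out (by norm_num)).mp hdvd
    exact card_torsion_le_of_intModel_of_card minTwist7_intModel 5 11 minTwist7_card_11 (by norm_num)

/-- **`5` is non-anomalous for `T₀`**: `a_5(T₀) − 1 = 1`. [cite: SilvermanAEC2009, VII.3 Prop. 3.1] -/
theorem minTwist7_nonAnomalous_5 :
    haveI := minTwist7_isGloballyMinimal; haveI := Fact.mk (by norm_num : Nat.Prime 5);
    ¬ ((5 : ℕ) : ℤ) ∣ ((⟨0, -1, 1, -212, -1184⟩ : WeierstrassCurve ℤ).map (Int.castRingHom ℚ)).frobeniusTrace 5 - 1 := by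
  haveI := minTwist7_isElliptic
  haveI := minTwist7_isGloballyMinimal
  haveI := Fact.mk (by norm_num : Nat.Prime 5)
  rw [IntModel.frobeniusTrace_eq minTwist7_intModel minTwist7_card_5]
  decide

/-- **Heegner data `d_K = −7` for `571b1`**: the prime `571` of `Δ = −571` splits in a quadratic field of discriminant `−7`
(`(−7/571) = 1`). [cite: Marcus1977, Ch. 3 Thm. 25] [cite: GrossLMS1991, §1] -/
theorem heegner_neg7 : ∀ q : ℕ, q.Prime → (q : ℤ) ∣ (⟨0, 1, 1, -4, 2⟩ : WeierstrassCurve ℤ).Δ →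
    (q = 2 → (-7 : ℤ) % 8 = 1) ∧ (q ≠ 2 → jacobiSym (-7) q = 1) :=
  forall_prime_dvd_of_natAbs_eq_pow (a := 571) (i := 1) (by decide +kernel) (by norm_num)
    ⟨by norm_num, by norm_num⟩

/-! ## The row at `p = 5`: the crux's clause at `571b1` from the two tree certificates -/

/-- **DEPTH-TABLE ROW `571b1`, `(p, d_K) = (5, −7)`, v17 — THE CRUX `KolyvaginDepthSupplyKN` AT `571b1` MODULO PRINT AND TWO IN-TREE
KURIHARA CERTIFICATES.** For EVERY imaginary quadratic `K` with `d_K = −7`: granted Kim 2026 Thm. 1.11 (`hKim`), modularity (`hnf`), Mazur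
1978 Cor. 4.1 (`hMaz`), W. Zhang 2014 L8.4 (1)/9.1 (`h84`) BY NAME and the CLAIMS of `cert_571b1` @ `(5, 11·41)` (`hδE`) and `cert_27979d1` @
`(5, 11)` (`hδT`), the clause of the crux holds at `W = 571b1` VERBATIM: witnesses `p = 5` (`goodOrdinary_5`, tower from
`hasSurjectiveModNGaloisRep_pow_5 1` by Serre, `kodairaNeron_of_five_le 5`), that `K` (`heegner_neg7`), W. Zhang's level-one class, first sign
(`2 ≤ rank`, `KernelCerts001.C571b1.two_le_rank`). CONDITIONAL on the four named facts and the two claims; per curve; nothing class-wide;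
BSD is not proved by it. [cite: Kim2022StructureSelmer, Thm. 1.11 (PDF p. 8)] [cite: WZhang2014, Lemma 8.4 (1) (p. 236), Thm. 9.1 (p. 240)]
[cite: Mazur1978, Cor. 4.1] [cite: CremonaAlgorithms1997, Table 1 (571b1)] -/
theorem cruxBody_of_kuriharaClaims_5_neg7
    (hKim : Kim2022_card_selmerGroup_le_pow_of_kuriharaNumber_ne_zero)
    (hnf : exists_isNewformOf) (hMaz : mazur_not_dvd_maninConstant_of_odd)
    (h84 : Literature.NumberTheory.EllipticCurves.WZhang2014_lemma84_exists_minimal_kolyvaginClass_one_selmerCard)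
    (K : Type) [Field K] [NumberField K] (hK : IsImaginaryQuadratic K) (hD : NumberField.discr K = -7)
    (hδE : haveI := isElliptic_c571b1; haveI := isGloballyMinimal_c571b1;
      haveI : NeZero (((⟨0, 1, 1, -4, 2⟩ : WeierstrassCurve ℤ).map (Int.castRingHom ℚ)).conductorNorm ℤ) :=
        neZero_conductorNorm_of_isElliptic _;
      haveI := Fact.mk (by norm_num : Nat.Prime 5);
      ∀ (D : ModularParametrizationData ((⟨0, 1, 1, -4, 2⟩ : WeierstrassCurve ℤ).map (Int.castRingHom ℚ))
          (((⟨0, 1, 1, -4, 2⟩ : WeierstrassCurve ℤ).map (Int.castRingHom ℚ)).conductorNorm ℤ)),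
        ¬ ((5 : ℕ) : ℤ) ∣ D.maninConstant →
        (∃ u : ℚ, ‖(u : ℚ_[5])‖ = 1 ∧
          ((⟨0, 1, 1, -4, 2⟩ : WeierstrassCurve ℤ).map (Int.castRingHom ℚ)).realPeriodRat = u * plusPeriod D.f) →
        ∃ ψ : (ℓ : ℕ) → (ZMod ℓ)ˣ →* Multiplicative (ZMod 5),
          (∀ ℓ ∈ (451 : ℕ).primeFactors, Function.Surjective (ψ ℓ)) ∧ kuriharaNumber D.f 5 451 ψ ≠ 0)
    (hδT : haveI := minTwist7_isElliptic; haveI := minTwist7_isGloballyMinimal;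
      haveI : NeZero (((⟨0, -1, 1, -212, -1184⟩ : WeierstrassCurve ℤ).map (Int.castRingHom ℚ)).conductorNorm ℤ) :=
        neZero_conductorNorm_of_isElliptic _;
      haveI := Fact.mk (by norm_num : Nat.Prime 5);
      ∀ (D : ModularParametrizationData ((⟨0, -1, 1, -212, -1184⟩ : WeierstrassCurve ℤ).map (Int.castRingHom ℚ))
          (((⟨0, -1, 1, -212, -1184⟩ : WeierstrassCurve ℤ).map (Int.castRingHom ℚ)).conductorNorm ℤ)),
        ¬ ((5 : ℕ) : ℤ) ∣ D.maninConstant →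
        (∃ u : ℚ, ‖(u : ℚ_[5])‖ = 1 ∧
          ((⟨0, -1, 1, -212, -1184⟩ : WeierstrassCurve ℤ).map (Int.castRingHom ℚ)).realPeriodRat = u * plusPeriod D.f) →
        ∃ ψ : (ℓ : ℕ) → (ZMod ℓ)ˣ →* Multiplicative (ZMod 5),
          (∀ ℓ ∈ (11 : ℕ).primeFactors, Function.Surjective (ψ ℓ)) ∧ kuriharaNumber D.f 5 11 ψ ≠ 0) :
    haveI := isElliptic_c571b1; haveI := isGloballyMinimal_c571b1;
    ∃ (p : ℕ) (hp : Fact p.Prime), 5 ≤ p ∧ ((⟨0, 1, 1, -4, 2⟩ : WeierstrassCurve ℤ).map (Int.castRingHom ℚ)).HasGoodReductionAtPrime p ∧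
      ¬ (p : ℤ) ∣ ((⟨0, 1, 1, -4, 2⟩ : WeierstrassCurve ℤ).map (Int.castRingHom ℚ)).frobeniusTrace p ∧
      (∀ n : ℕ, ((⟨0, 1, 1, -4, 2⟩ : WeierstrassCurve ℤ).map (Int.castRingHom ℚ)).HasSurjectiveModNGaloisRep (p ^ n : ℕ)) ∧
      (∀ v : HeightOneSpectrum (𝓞 ℚ), ((⟨0, 1, 1, -4, 2⟩ : WeierstrassCurve ℤ).map (Int.castRingHom ℚ)).HasMultiplicativeReductionAt v →
        ¬ p ∣ ((⟨0, 1, 1, -4, 2⟩ : WeierstrassCurve ℤ).map (Int.castRingHom ℚ)).ordMinimalDiscriminant v) ∧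
      ∃ (K : Type) (_ : Field K) (_ : NumberField K), IsImaginaryQuadratic K ∧
        NumberField.discr K ≠ -3 ∧ NumberField.discr K ≠ -4 ∧
        ∃ (_ : NeZero (((⟨0, 1, 1, -4, 2⟩ : WeierstrassCurve ℤ).map (Int.castRingHom ℚ)).conductorNorm ℤ)),
          SatisfiesHeegnerHypothesis (((⟨0, 1, 1, -4, 2⟩ : WeierstrassCurve ℤ).map (Int.castRingHom ℚ)).conductorNorm ℤ) K ∧
        ∃ (Dt : ModularParametrizationData ((⟨0, 1, 1, -4, 2⟩ : WeierstrassCurve ℤ).map (Int.castRingHom ℚ))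
            (((⟨0, 1, 1, -4, 2⟩ : WeierstrassCurve ℤ).map (Int.castRingHom ℚ)).conductorNorm ℤ)) (β : ℤ) (ι : K →+* ℂ) (n₁ : ℕ)
          (d : KolyvaginHeegnerData Dt β ι n₁), Squarefree n₁ ∧
          (∀ q ∈ n₁.primeFactors, Zhang2014.IsKolyvaginPrime (((⟨0, 1, 1, -4, 2⟩ : WeierstrassCurve ℤ).map (Int.castRingHom ℚ)).conductorNorm ℤ)
            ((⟨0, 1, 1, -4, 2⟩ : WeierstrassCurve ℤ).map (Int.castRingHom ℚ)) K p q) ∧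
          d.kolyvaginClass hp.out 1 ≠ 0 ∧
          (n₁.primeFactors.card + 1 ≤ ((⟨0, 1, 1, -4, 2⟩ : WeierstrassCurve ℤ).map (Int.castRingHom ℚ)).mordellWeilRank ∨
            (n₁.primeFactors.card ≤ ((⟨0, 1, 1, -4, 2⟩ : WeierstrassCurve ℤ).map (Int.castRingHom ℚ)).mordellWeilRank ∧
              n₁.primeFactors.card + 1 ≤
                (((⟨0, 1, 1, -4, 2⟩ : WeierstrassCurve ℤ).map (Int.castRingHom ℚ)).quadraticTwist (NumberField.discr K : ℚ)).mordellWeilRank)) := by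
  haveI := isElliptic_c571b1
  haveI := isGloballyMinimal_c571b1
  haveI iNZ : NeZero (((⟨0, 1, 1, -4, 2⟩ : WeierstrassCurve ℤ).map (Int.castRingHom ℚ)).conductorNorm ℤ) :=
    neZero_conductorNorm_of_isElliptic _
  haveI iP := Fact.mk (by norm_num : Nat.Prime 5)
  haveI := minTwist7_isElliptic
  haveI := minTwist7_isGloballyMinimal
  haveI iNZT : NeZero (((⟨0, -1, 1, -212, -1184⟩ : WeierstrassCurve ℤ).map (Int.castRingHom ℚ)).conductorNorm ℤ) :=
    neZero_conductorNorm_of_isElliptic _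
  haveI : NeZero (451 : ℕ) := ⟨by norm_num⟩
  haveI : NeZero (11 : ℕ) := ⟨by norm_num⟩
  have hsp := spadeOne_of_five_le 5 (by norm_num)
  have hS2 : ¬ Squarefree (((⟨0, 1, 1, -4, 2⟩ : WeierstrassCurve ℤ).map (Int.castRingHom ℚ)).conductorNorm ℤ) →
      (∃ (ℓ : ℕ) (_ : Fact ℓ.Prime), ((⟨0, 1, 1, -4, 2⟩ : WeierstrassCurve ℤ).map (Int.castRingHom ℚ)).HasMultiplicativeReductionAtPrime ℓ ∧
          ¬ 5 ∣ padicValInt ℓ ((⟨0, 1, 1, -4, 2⟩ : WeierstrassCurve ℤ).map (Int.castRingHom ℚ)).minimalDiscriminantInt) ∧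
        ∃ (ℓ₁ ℓ₂ : ℕ) (_ : Fact ℓ₁.Prime) (_ : Fact ℓ₂.Prime), ℓ₁ ≠ ℓ₂ ∧
          ((⟨0, 1, 1, -4, 2⟩ : WeierstrassCurve ℤ).map (Int.castRingHom ℚ)).HasMultiplicativeReductionAtPrime ℓ₁ ∧
          ((⟨0, 1, 1, -4, 2⟩ : WeierstrassCurve ℤ).map (Int.castRingHom ℚ)).HasMultiplicativeReductionAtPrime ℓ₂ :=
    fun hns ↦ absurd (((⟨0, 1, 1, -4, 2⟩ : WeierstrassCurve ℤ).map (Int.castRingHom ℚ)).isSemistable_iff_squarefree_conductorNorm.mp hsp.2) hns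
  have hH : SatisfiesHeegnerHypothesis (((⟨0, 1, 1, -4, 2⟩ : WeierstrassCurve ℤ).map (Int.castRingHom ℚ)).conductorNorm ℤ) K :=
    satisfiesHeegnerHypothesis_conductorNorm_of_intModel intModel K hK.1 hD heegner_neg7
  have hD3 : NumberField.discr K ≠ -3 := by rw [hD]; norm_num
  have hD4 : NumberField.discr K ≠ -4 := by rw [hD]; norm_num
  have hpD : ¬ (((5 : ℕ) : ℤ) ∣ NumberField.discr K) := by rw [hD]; decide
  have hsur : ((⟨0, 1, 1, -4, 2⟩ : WeierstrassCurve ℤ).map (Int.castRingHom ℚ)).HasSurjectiveModNGaloisRep (5 ^ 1 : ℕ) :=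
    hasSurjectiveModNGaloisRep_pow_5 1
  rw [pow_one] at hsur
  have htower : ∀ k : ℕ, ((⟨0, 1, 1, -4, 2⟩ : WeierstrassCurve ℤ).map (Int.castRingHom ℚ)).HasSurjectiveModNGaloisRep (5 ^ k : ℕ) :=
    serre_hasSurjectiveModNGaloisRep_pow_holds _ 5 (by norm_num) hsur
  have hC : (⟨1, (-2 : ℚ), (0 : ℚ), -((1 : ℚ) / 2)⟩ : WeierstrassCurve.VariableChange ℚ) •
      ((⟨0, -1, 1, -212, -1184⟩ : WeierstrassCurve ℤ).map (Int.castRingHom ℚ)) =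
      ((⟨0, 1, 1, -4, 2⟩ : WeierstrassCurve ℤ).map (Int.castRingHom ℚ)).quadraticTwist (NumberField.discr K : ℚ) := by
    rw [hD]; push_cast; exact minTwist7_smul_eq
  have hrank : 2 ≤ ((⟨0, 1, 1, -4, 2⟩ : WeierstrassCurve ℤ).map (Int.castRingHom ℚ)).mordellWeilRank := KernelCerts001.C571b1.two_le_rank
  have hν : (451 : ℕ).primeFactors.card ≤ ((⟨0, 1, 1, -4, 2⟩ : WeierstrassCurve ℤ).map (Int.castRingHom ℚ)).mordellWeilRank := by
    refine le_trans (le_of_eq ?_) hrank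
    rw [show (451 : ℕ) = 11 * 41 from rfl, Nat.primeFactors_mul (by norm_num) (by norm_num),
      Nat.Prime.primeFactors (by norm_num), Nat.Prime.primeFactors (by norm_num)]
    decide
  have hμ : (11 : ℕ).primeFactors.card ≤ ((⟨0, 1, 1, -4, 2⟩ : WeierstrassCurve ℤ).map (Int.castRingHom ℚ)).mordellWeilRank := by
    rw [Nat.Prime.primeFactors (by norm_num), Finset.card_singleton]
    exact le_trans (by norm_num) hrank
  exact cruxBody_of_kuriharaClaims_spade hKim hnf hMaz h84 _ hrank 5 le_rfl goodOrdinary_5.1 goodOrdinary_5.2 htower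
    (kodairaNeron_of_five_le 5 le_rfl) nonAnomalous_5 hsp.1 hS2 K hK hD3 hD4 hpD hH
    451 isCyclicKolyvaginLevel_5_451 hν hδE
    ((⟨0, -1, 1, -212, -1184⟩ : WeierstrassCurve ℤ).map (Int.castRingHom ℚ)) _ hC minTwist7_nonAnomalous_5
    minTwist7_kodairaNeron_5 11 minTwist7_isCyclicKolyvaginLevel_5_11 hμ hδT

end C571b1

end Summit.BirchSwinnertonDyer.BirchSwinnertonDyer.Theorems.KolyvaginDepthDoor

end
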